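import Mathlib
import Summits.Ventures.HodgeRepro2.HodgePeterssonBridge
import Summits.Ventures.HodgeRepro2.CoveringIntegralBall
import Summits.Ventures.HodgeRepro2.HeckeSlashSelfAdjoint

/-!
# HodgePeriodTower — the `(N)`-period is independent of the level, up to the index

Blind cell `pub-hodge-repro2`, seat p2 (Tier 5, sub-step N1 = IDENTIFICATION, §ID-4(b′) / §ID-5,
gap G-ID-4 «level bookkeeping»).

For `S' ≤ S` of finite index and a measurable fundamental domain `D` of `S`, the coset domain
`D' = ⋃_q r_q⁻¹ • D` is a fundamental domain of `S'` (`BallQuotientCoverMeasure.lean`, row 112) and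
the Petersson product scales by the index (`CoveringIntegralBall.lean`, row 113). Through the
bridge (`HodgePeterssonBridge.lean`, row 118) the coefficient-model period of two weight-3 forms
for `S`, computed over `D'`, is `[S : S']` times the period over `D`; in particular `(N)` holds at
the level `S'` iff it holds at the level `S` — the descent of `(N)` along the congruence tower.
-/

namespace Summit.Ventures.HodgeRepro2.ShimuraData

open MeasureTheory

variable {K : Type*} [Field K] [NumberField K] [NumberField.IsCMField K] {τ₁ : K →+* ℂ}
  {H : Matrix (Fin 3) (Fin 3) K} {Q : Matrix (Fin 3) (Fin 3) ℂ} (hQ : IsFrame K τ₁ H Q)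
  {S' S : Subgroup (GL (Fin 3) K)} (hS'S : S' ≤ S)
  (hS : (S : Set (GL (Fin 3) K)) ⊆ unitaryGroup K H) [hfi : (S'.subgroupOf S).FiniteIndex]
  {D : Set ball₂} (hDm : MeasurableSet D) (hD : IsBallFundamentalDomain hQ S hS D)

include hS'S hDm hD in
/-- **The period scales by the index along the tower**: for weight-3 forms `f`, `g` for `S`
(continuous on the ball), the coefficient-model period over the coset domain of `S' ≤ S` is
`[S : S']` times the period over the fundamental domain `D` of `S`. -/
theorem setIntegral_hodgeWedge_cosetDomain {f g : (Fin 2 → ℂ) → ℂ} (hf : IsWeightFor τ₁ Q S 3 f)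
    (hg : IsWeightFor τ₁ Q S 3 g) (hfc : ContinuousOn f ball₂) (hgc : ContinuousOn g ball₂) :
    ∫ x in Subtype.val '' cosetDomain (S' := S') hQ hS D, hodgeWedge f g x
      = ((S'.subgroupOf S).index : ℂ) * ∫ x in Subtype.val '' D, hodgeWedge f g x := by
  rw [setIntegral_hodgeWedge_eq_peterssonInner hQ S' (hS'S.trans hS)
      (measurableSet_cosetDomain hQ S hS hDm) (hf.mono hS'S) (hg.mono hS'S) hfc hgc,
    setIntegral_hodgeWedge_eq_peterssonInner hQ S hS hDm hf hg hfc hgc,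
    peterssonInner_mono_eq_index_mul hQ hS'S hS hDm hD hf hg hfc hgc]
  ring

include hS'S hDm hD in
/-- **`(N)` descends the tower**: for `S' ≤ S` of finite index, the period over the coset domain
of `S'` is non-zero iff the period over the fundamental domain of `S` is. -/
theorem setIntegral_hodgeWedge_cosetDomain_ne_zero_iff {f g : (Fin 2 → ℂ) → ℂ}
    (hf : IsWeightFor τ₁ Q S 3 f) (hg : IsWeightFor τ₁ Q S 3 g) (hfc : ContinuousOn f ball₂)
    (hgc : ContinuousOn g ball₂) :
    ∫ x in Subtype.val '' cosetDomain (S' := S') hQ hS D, hodgeWedge f g x ≠ 0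
      ↔ ∫ x in Subtype.val '' D, hodgeWedge f g x ≠ 0 := by
  rw [setIntegral_hodgeWedge_cosetDomain hQ hS'S hS hDm hD hf hg hfc hgc, mul_ne_zero_iff]
  have h : ((S'.subgroupOf S).index : ℂ) ≠ 0 := by
    exact_mod_cast (Subgroup.finiteIndex_iff.mp hfi)
  exact ⟨fun h' => h'.2, fun h' => ⟨h, h'⟩⟩

end Summit.Ventures.HodgeRepro2.ShimuraData
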